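import Summits.QuantumAdvantage.QuantumAdvantage.Theorems.LinnikCubicClassGroupsDegreeOnePrimesEscapeConjClassShortIntervalDHRelative
import Summits.QuantumAdvantage.QuantumAdvantage.Theorems.LinnikCubicClassGroupsDegreeOnePrimesEscapeConjClassShortIntervalDHCorollaries
import HarnessLib

/-!
# Primes of `F` with prescribed Frobenius class in `Gal(N/F)` in every short interval — arbitrary base, every class

Topic `Summits/QuantumAdvantage/QuantumAdvantage/Theorems`, cell B2b-1 (linnik-cubic), PART A (gen 19); helper toward the
crux `DegreeOnePrimesEscape` (stmt-QuantumAdvantage-11543) of route `LinnikCubicClassGroups` (value = theorem, NOT summit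
progress).

**Theorem (`exists_prime_frobenius_mem_shortInterval_relative`).**  For every `n > 1` there are `δ, L > 0` such that for
every Galois extension `N/F` of number fields with `[N:ℚ] = n`, every `σ ∈ Gal(N/F)`, every `x ≥ |d_N|^L` and every `h`
with `x^{1−δ} ≤ h ≤ x`, there is a prime `𝔮` of `F` of degree one (`N𝔮 = p` prime, `p ∤ d_N`) with `x < N𝔮 ≤ x + h`
whose Frobenius class in `Gal(N/F)` is `C(σ)` — unconditionally, over an ARBITRARY base `F` (the relative error of
`frobeniusClass_shortInterval_dh_relative` in the flat regime is what removes the exceptional-class proviso).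
With `h = x` this is the least-prime theorem `exists_prime_isArithFrobAt_le_relative` (gen 16) in every dyadic block.
-/

noncomputable section

open scoped NumberField nonZeroDivisors Classical
open Finset Real Ideal NumberField IsDedekindDomain
open Literature.NumberTheory.NumberFields Literature.NumberTheory.LFunctions
  Literature.NumberTheory.LFunctions.NumberField Literature.NumberTheory.GaloisRepresentations

namespace Summit.QuantumAdvantage.QuantumAdvantage.Theorems.DegreeOnePrimesEscape

/-- If the `log N𝔮`-weighted count of the prime ideals `𝔮` of `F` with `N𝔮 ≤ y` and property `P` strictly increases
from `y = x` to `y = x + h`, there is a prime ideal `𝔮` with `x < N𝔮 ≤ x + h` and `P 𝔮`. -/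
theorem exists_primeIdeal_of_logSum_lt {F : Type} [Field F] [NumberField F] {P : Ideal (𝓞 F) → Prop}
    [DecidablePred P] {x h : ℝ} (hh : 0 ≤ h)
    (hlt : (∑ q ∈ (finite_primeIdealsLE F x).toFinset with P q, Real.log (Ideal.absNorm q : ℝ)) <
      ∑ q ∈ (finite_primeIdealsLE F (x + h)).toFinset with P q, Real.log (Ideal.absNorm q : ℝ)) :
    ∃ q : Ideal (𝓞 F), q.IsPrime ∧ q ≠ ⊥ ∧ x < (Ideal.absNorm q : ℝ) ∧ (Ideal.absNorm q : ℝ) ≤ x + h ∧ P q := by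
  have hsub : ((finite_primeIdealsLE F x).toFinset.filter P) ⊆ ((finite_primeIdealsLE F (x + h)).toFinset.filter P) := by
    intro q hq
    rw [Finset.mem_filter, mem_primeIdealsLE_toFinset] at hq ⊢
    exact ⟨⟨hq.1.1, hq.1.2.1, hq.1.2.2.trans (by linarith)⟩, hq.2⟩
  have hS : 0 < ∑ q ∈ ((finite_primeIdealsLE F (x + h)).toFinset.filter P) \
      ((finite_primeIdealsLE F x).toFinset.filter P), Real.log (Ideal.absNorm q : ℝ) := by
    rw [← Finset.sum_sdiff hsub] at hlt; linarith
  obtain ⟨q, hq, -⟩ := Finset.exists_ne_zero_of_sum_ne_zero hS.ne'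
  rw [Finset.mem_sdiff, Finset.mem_filter, mem_primeIdealsLE_toFinset] at hq
  obtain ⟨⟨⟨hqP, hq0, hqle⟩, hPq⟩, hnot⟩ := hq
  refine ⟨q, hqP, hq0, ?_, hqle, hPq⟩
  by_contra hle
  rw [not_lt] at hle
  exact hnot (by rw [Finset.mem_filter, mem_primeIdealsLE_toFinset]; exact ⟨⟨hqP, hq0, hle⟩, hPq⟩)

/-- **Every short interval `(x, x+h]` of the Linnik range (`x ≥ |d_N|^L`, `x^{1−δ} ≤ h ≤ x`) contains the norm of a
degree-one prime `𝔮` of `F` (`N𝔮 = p ∤ d_N` prime) with Frobenius class `C(σ)` in `Gal(N/F)` — for EVERY `σ`, EVERY Galois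
`N/F` over EVERY base number field `F`, unconditionally.**
[cite: LagariasMontgomeryOdlyzko1979, Theorem 1.1] [cite: Stark1974, Theorem 1'] -/
theorem exists_prime_frobenius_mem_shortInterval_relative (n : ℕ) (hn : 1 < n) :
    ∃ δ L : ℝ, 0 < δ ∧ δ ≤ 1 / 64 ∧ 0 < L ∧
      ∀ (F N : Type) [Field F] [NumberField F] [Field N] [NumberField N] [Algebra F N] [IsGalois F N],
      Module.finrank ℚ N = n → ∀ σ : N ≃ₐ[F] N,
      ∀ x h : ℝ, ((NumberField.discr N).natAbs : ℝ) ^ L ≤ x → x ^ (1 - δ) ≤ h → h ≤ x →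
        ∃ q : Ideal (𝓞 F), q.IsPrime ∧ q ≠ ⊥ ∧ x < (Ideal.absNorm q : ℝ) ∧ (Ideal.absNorm q : ℝ) ≤ x + h ∧
          (Ideal.absNorm q).Prime ∧ ¬ ((Ideal.absNorm q : ℤ) ∣ NumberField.discr N) ∧
          ∃ (Q : Ideal (𝓞 N)) (_ : Q.IsMaximal) (_ : Q.LiesOver q) (φ g : N ≃ₐ[F] N),
            IsArithFrobAt (𝓞 F) φ Q ∧ Q.inertia (N ≃ₐ[F] N) = ⊥ ∧ g * φ * g⁻¹ = σ := by
  obtain ⟨δ, L, c, hδ0, hδ64, hL0, hc0, hc4, -, hmain⟩ :=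
    frobeniusClass_shortInterval_dh_relative n hn (κ := 1 / 2) (by norm_num) (by norm_num)
  refine ⟨δ, L, hδ0, hδ64, hL0, fun F N _ _ _ _ _ _ hN σ x h hx hhx hhx' => ?_⟩
  obtain ⟨hA, hB⟩ := hmain F N hN σ x h hx hhx hhx'
  have hN1 : 1 < Module.finrank ℚ N := by rw [hN]; exact hn
  have hd3 : (3 : ℝ) ≤ ((NumberField.discr N).natAbs : ℝ) := three_le_natAbs_discr_real N hN1
  have hx1 : 1 < x := by
    have h1 : (3 : ℝ) ^ L ≤ ((NumberField.discr N).natAbs : ℝ) ^ L :=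
      Real.rpow_le_rpow (by norm_num) hd3 hL0.le
    have h2 : (1 : ℝ) < (3 : ℝ) ^ L := Real.one_lt_rpow (by norm_num) hL0
    linarith
  have hx0 : 0 < x := by linarith
  have hh0 : 0 < h := lt_of_lt_of_le (Real.rpow_pos_of_pos hx0 _) hhx
  have hdC0 : 0 < (Nat.card {τ : N ≃ₐ[F] N // IsConj σ τ} : ℝ) / Nat.card (N ≃ₐ[F] N) := by
    have h1 : 0 < Nat.card {τ : N ≃ₐ[F] N // IsConj σ τ} := by
      haveI : Nonempty {τ : N ≃ₐ[F] N // IsConj σ τ} := ⟨⟨σ, IsConj.refl σ⟩⟩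
      exact Nat.card_pos
    have h2 : 0 < Nat.card (N ≃ₐ[F] N) := Nat.card_pos
    exact div_pos (by exact_mod_cast h1) (by exact_mod_cast h2)
  set δC : ℝ := (Nat.card {τ : N ≃ₐ[F] N // IsConj σ τ} : ℝ) / Nat.card (N ≃ₐ[F] N) with hδC
  set P : Ideal (𝓞 F) → Prop := fun q => (Ideal.absNorm q).Prime ∧ ¬ ((Ideal.absNorm q : ℤ) ∣ NumberField.discr N) ∧
    ∃ (Q : Ideal (𝓞 N)) (_ : Q.IsMaximal) (_ : Q.LiesOver q) (φ g : N ≃ₐ[F] N),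
      IsArithFrobAt (𝓞 F) φ Q ∧ Q.inertia (N ≃ₐ[F] N) = ⊥ ∧ g * φ * g⁻¹ = σ with hP
  -- the count increases strictly across `(x, x+h]`
  have hlt : (∑ q ∈ (finite_primeIdealsLE F x).toFinset with P q, Real.log (Ideal.absNorm q : ℝ)) <
      ∑ q ∈ (finite_primeIdealsLE F (x + h)).toFinset with P q, Real.log (Ideal.absNorm q : ℝ) := by
    have hδCh : 0 < δC * h := mul_pos hdC0 hh0
    by_cases hz : ∃ β₁ : ℝ, dedekindZeta₁ N β₁ = 0 ∧
        1 - c / (Real.log ((NumberField.discr N).natAbs : ℝ) + Real.log 4) < β₁ ∧ β₁ < 1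
    · obtain ⟨β₁, hζ, hwin, hβ1⟩ := hz
      obtain ⟨hBp, hBm⟩ := hB β₁ hζ hwin hβ1
      have hβ0 : 0 < β₁ := by
        have hlogd : 0 < Real.log ((NumberField.discr N).natAbs : ℝ) := Real.log_pos (by linarith)
        have hlog4 : 1 < Real.log 4 := by
          rw [show (4:ℝ) = 2 ^ 2 by norm_num, Real.log_pow]; have := Real.log_two_gt_d9; push_cast; linarith
        have : c / (Real.log ((NumberField.discr N).natAbs : ℝ) + Real.log 4) ≤ 1 / 4 := by
          rw [div_le_iff₀ (by linarith)]; nlinarith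
        linarith
      by_cases hζE : dedekindZeta₁ (IntermediateField.fixedField (Subgroup.zpowers σ)) β₁ = 0
      · -- flat regime: relative error, and the flat main term is positive
        have hbd := (abs_le.1 (hBp hζE)).1
        have hflat := half_min_mul_le_flat hx1.le hh0.le hβ0 hβ1
        have hμ0 : 0 < min 1 ((1 - β₁) * Real.log x) :=
          lt_min one_pos (mul_pos (by linarith) (Real.log_pos hx1))
        have hpos : 0 < h - ((x + h) ^ β₁ - x ^ β₁) / β₁ := by nlinarith
        have hmain0 : 0 < δC * (h - ((x + h) ^ β₁ - x ^ β₁) / β₁) := mul_pos hdC0 hpos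
        linarith
      · have hbd := (abs_le.1 (hBm hζE)).1
        have hI := (rpow_window_div_mem hx1.le hh0.le hβ0 hβ1.le).1
        have := mul_nonneg hdC0.le hI
        have e : δC * (h + ((x + h) ^ β₁ - x ^ β₁) / β₁) = δC * h + δC * (((x + h) ^ β₁ - x ^ β₁) / β₁) := by
          ring
        linarith
    · have hbd := (abs_le.1 (hA hz)).1
      linarith
  obtain ⟨q, hqP, hq0, hxq, hqx, hPq⟩ := exists_primeIdeal_of_logSum_lt hh0.le hlt
  exact ⟨q, hqP, hq0, hxq, hqx, hPq.1, hPq.2.1, hPq.2.2⟩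

end Summit.QuantumAdvantage.QuantumAdvantage.Theorems.DegreeOnePrimesEscape

end
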